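import Literature.IUT.HodgeArakelov.MonoThetaProjectiveR
import Literature.IUT.HodgeArakelov.Prop13ToyModel
import Literature.IUT.HodgeArakelov.Def11OutputTransport

/-!
# [IUTchII] Prop. 1.5 (i)′ is still a schema, I: the monomial combinatorics of the lim¹ twin (toy, pure algebra)

S. Mochizuki, *Inter-universal Teichmüller theory II*, kurims manuscript (Dec. 2020), §1, Prop. 1.5 (i) p. 29: "Such a
projective system [of mono-theta environments] is uniquely determined, up to isomorphism, by `X̲̲_k` [cf. Remark 1.5.1
below; the discrete rigidity property of [EtTh], Corollary 2.19, (ii)]" [claim: Mochizuki2012, status: disputed]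
(IUTchII §1 Prop 1.5 (i), kurims p.29).  abc-iut cell, block F (FACT-proving wave, D-0078 rung A2.C), seat abc-iut-f-130
(gen 8), FACT-LIST row **F-0670** `Prop15_i'` (the REPAIRED decl of record, `MonoThetaProjectiveR.lean`, abc-iut-L6-t19).

THE QUESTION.  The repair `Prop15_i' R A B` asks, of two projective systems `A`, `B` whose transitions are — arrow by
arrow — the model reductions `R` up to isomorphisms of mono-theta environments at both ends (`IsMonoThetaCompatible R`),
that they be isomorphic by ONE compatible family of isomorphisms.  Print derives this from DISCRETE RIGIDITY ([EtTh]
Cor. 2.19 (ii)): for GENUINE mono-theta environments all the arrow-wise twists straighten SIMULTANEOUSLY.  The typed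
interface (`ModelFamily`, `ModelFamily.Reductions`, `MonoThetaEnv.Iso`) is free, and over a JUNK model family the
arrow-wise twists form a non-trivial 1-cocycle of the tower of automorphism groups — a `lim¹ ≠ 0` phenomenon — so the
universal closure of `Prop15_i'` is FALSE (file `MonoThetaProjectiveProp15iPrimeSchemaCertificate.lean`).

THIS FILE (pure algebra, no topology, no [IUTchII] object): the monoid of MONOMIALS `Mon := ℤ × Multiset ℕ`
(`x^a · v_{i₁} ⋯ v_{i_r}`, `a ∈ ℤ`), the surjective endomorphism `φ : x ↦ x³, v₀ ↦ x, v_{i+1} ↦ v_i`, the CONES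
`T_m ⊆ ℤ^{(Mon)}` (finsupps supported in the up-set of `m`), the index maps `g_{d,k} = x^k · φ^d` with their COCYCLE LAW
`g_{d,k} ∘ g_{d',k'} = g_{d+d',k+3^d k'}`, the fact that `g_{d,k}` carries `T_m` onto `T_{g_{d,k}(m)}`, and the
ORDER-THEORETIC CORE: the pure powers `x^n` are exactly the monomials below which divisibility is a total order, and an
order-automorphism of `ℤ` is a translation.  JUNK/TOY by design; nothing here refers to a curve, a theta function or a
genuine mono-theta environment; no side taken on [IUTchIII] Cor. 3.12; typed ≠ proved.
-/

namespace Literature.IUT.HodgeArakelov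

namespace LimOneToy

/-- Monomials `x^a · v^s` (`a ∈ ℤ`, `s` a multiset of variable indices), additively. [claim: Mochizuki2012, status: disputed] (IUTchII §1 Prop 1.5 (i), kurims p.29) -/
abbrev Mon : Type := ℤ × Multiset ℕ

/-- `φ : x ↦ x³, v₀ ↦ x, v_{i+1} ↦ v_i` on exponents: `(a; s) ↦ (3a + #zeros(s); pred(s ∖ zeros))`. [claim: Mochizuki2012, status: disputed] (IUTchII §1 Prop 1.5 (i), kurims p.29) -/
def φ : Mon →+ Mon where
  toFun m := (3 * m.1 + (Multiset.count 0 m.2 : ℤ), (m.2.filter (fun i => i ≠ 0)).map Nat.pred)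
  map_zero' := by simp
  map_add' m m' := by
    ext1
    · simp only [Prod.fst_add, Prod.snd_add, Multiset.count_add, Nat.cast_add]
      ring
    · simp only [Prod.snd_add, Multiset.filter_add, Multiset.map_add]

/-- The `x`-exponent of `φ(m)`: `3a + #zeros`. [claim: Mochizuki2012, status: disputed] (IUTchII §1 Prop 1.5 (i), kurims p.29) -/
theorem φ_fst (m : Mon) : (φ m).1 = 3 * m.1 + (Multiset.count 0 m.2 : ℤ) := rfl
/-- The `v`-part of `φ(m)`: drop the `v₀`'s, shift the other variables down. [claim: Mochizuki2012, status: disputed] (IUTchII §1 Prop 1.5 (i), kurims p.29) -/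
theorem φ_snd (m : Mon) : (φ m).2 = (m.2.filter (fun i => i ≠ 0)).map Nat.pred := rfl

/-- `φ` is monotone for the product order (`ℤ` with `≤`, multisets with `≤`). [claim: Mochizuki2012, status: disputed] (IUTchII §1 Prop 1.5 (i), kurims p.29) -/
theorem φ_mono {m m' : Mon} (h : m ≤ m') : φ m ≤ φ m' := by
  obtain ⟨h1, h2⟩ := Prod.le_def.mp h
  refine Prod.le_def.mpr ⟨?_, ?_⟩
  · rw [φ_fst, φ_fst]
    have := Multiset.count_le_of_le 0 h2
    omega
  · rw [φ_snd, φ_snd]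
    exact Multiset.map_le_map (Multiset.filter_le_filter _ h2)

/-- The section property: `φ` maps the up-set of `m` ONTO the up-set of `φ m`. [claim: Mochizuki2012, status: disputed] (IUTchII §1 Prop 1.5 (i), kurims p.29) -/
theorem φ_surjOn (m : Mon) : Set.SurjOn φ (Set.Ici m) (Set.Ici (φ m)) := by
  rintro ⟨b, t⟩ hbt
  obtain ⟨hb, ht⟩ := Prod.le_def.mp (Set.mem_Ici.mp hbt)
  rw [φ_fst] at hb
  rw [φ_snd] at ht
  obtain ⟨a, s⟩ := m
  simp only at hb ht
  -- decompose `s` into its zeros and its nonzero part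
  set c : ℕ := Multiset.count 0 s with hc
  set splus := s.filter (fun i => i ≠ 0) with hsplus
  have hs : s = Multiset.replicate c 0 + splus := by
    rw [hc, hsplus, ← Multiset.filter_eq' s 0, Multiset.filter_add_not]
  -- the preimage: `a` unchanged, `(b - 3a)` zeros, and `succ` of `t`
  have hb' : 0 ≤ b - 3 * a - c := by omega
  refine ⟨(a, Multiset.replicate (b - 3 * a).toNat 0 + t.map Nat.succ), ?_, ?_⟩
  · -- it lies above `(a, s)`
    refine Set.mem_Ici.mpr (Prod.le_def.mpr ⟨le_rfl, ?_⟩)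
    show s ≤ _
    rw [hs]
    refine add_le_add ?_ ?_
    · refine (Multiset.replicate_le_replicate 0).mpr ?_
      omega
    · have h1 : splus = (splus.map Nat.pred).map Nat.succ := by
        rw [Multiset.map_map]
        conv_lhs => rw [← Multiset.map_id splus]
        refine Multiset.map_congr rfl fun i hi => ?_
        have hi' : i ∈ s.filter (fun i => i ≠ 0) := by rw [hsplus] at hi; exact hi
        have hi0 : i ≠ 0 := (Multiset.mem_filter.mp hi').2
        show id i = Nat.succ (Nat.pred i)
        rw [id, Nat.succ_pred_eq_of_ne_zero hi0]
      rw [h1]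
      exact Multiset.map_le_map ht
  · -- and maps to `(b, t)`
    ext1
    · rw [φ_fst]
      simp only [Multiset.count_add, Multiset.count_replicate_self]
      rw [Multiset.count_eq_zero_of_notMem (by simp), add_zero]
      omega
    · rw [φ_snd]
      simp only [Multiset.filter_add, Multiset.map_add]
      rw [Multiset.filter_eq_nil.mpr (by intro i hi; simp [Multiset.eq_of_mem_replicate hi]),
        Multiset.filter_eq_self.mpr (by simp), Multiset.map_map]
      simp

/-- `φ` is surjective. [claim: Mochizuki2012, status: disputed] (IUTchII §1 Prop 1.5 (i), kurims p.29) -/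
theorem φ_surjective : Function.Surjective φ := fun m'' => by
  -- `m''` lies above `φ m` for `m := (min, 0)` small enough
  obtain ⟨b, t⟩ := m''
  have h : φ ((min b 0 - 1, 0) : Mon) ≤ (b, t) := by
    refine Prod.le_def.mpr ⟨?_, ?_⟩
    · rw [φ_fst]
      simp only [Multiset.count_zero, Nat.cast_zero, add_zero]
      omega
    · rw [φ_snd]; simp
  obtain ⟨m', -, hm'⟩ := φ_surjOn _ (Set.mem_Ici.mpr h)
  exact ⟨m', hm'⟩

open Finsupp

/-! ## Cones of finsupps -/

/-- `cone m`: the finitely supported `ℤ`-valued functions on monomials supported in the up-set of `m`. [claim: Mochizuki2012, status: disputed] (IUTchII §1 Prop 1.5 (i), kurims p.29) -/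
def cone (m : Mon) : AddSubgroup (Mon →₀ ℤ) where
  carrier := {f | ∀ m' ∈ f.support, m ≤ m'}
  add_mem' := by
    intro f g hf hg m' hm'
    rcases Finset.mem_union.mp (Finsupp.support_add hm') with h | h
    · exact hf _ h
    · exact hg _ h
  zero_mem' := by
    intro m' hm'
    simp at hm'
  neg_mem' := by
    intro f hf m' hm'
    rw [Finsupp.support_neg] at hm'
    exact hf _ hm'

/-- Membership in a cone: the support lies in the up-set. [claim: Mochizuki2012, status: disputed] (IUTchII §1 Prop 1.5 (i), kurims p.29) -/
theorem mem_cone {m : Mon} {f : Mon →₀ ℤ} : f ∈ cone m ↔ ∀ m' ∈ f.support, m ≤ m' := Iff.rfl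

/-- The monomial `m` itself (i.e. `1·m`) lies in the cone of `m`. [claim: Mochizuki2012, status: disputed] (IUTchII §1 Prop 1.5 (i), kurims p.29) -/
theorem single_mem_cone (m : Mon) : Finsupp.single m (1 : ℤ) ∈ cone m := by
  intro m' hm'
  rw [(Finsupp.mem_support_single _ _ _).mp hm' |>.1]

/-- Cones are ordered by REVERSE divisibility of their apices: `T_m ⊆ T_{m'} ↔ m' ≤ m`. [claim: Mochizuki2012, status: disputed] (IUTchII §1 Prop 1.5 (i), kurims p.29) -/
theorem cone_le_cone_iff {m m' : Mon} : cone m ≤ cone m' ↔ m' ≤ m := by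
  constructor
  · intro h
    exact h (single_mem_cone m) m ((Finsupp.mem_support_single _ _ _).mpr ⟨rfl, one_ne_zero⟩)
  · intro h f hf m'' hm''
    exact h.trans (hf m'' hm'')

/-- Distinct monomials have distinct cones. [claim: Mochizuki2012, status: disputed] (IUTchII §1 Prop 1.5 (i), kurims p.29) -/
theorem cone_injective : Function.Injective cone := fun _ _ h =>
  le_antisymm (cone_le_cone_iff.mp h.symm.le) (cone_le_cone_iff.mp h.le)

/-- Direct images of cones under `mapDomain g` for an index map `g` carrying `↑m` onto `↑m''`. [claim: Mochizuki2012, status: disputed] (IUTchII §1 Prop 1.5 (i), kurims p.29) -/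
theorem map_cone_eq {g : Mon → Mon} {m m'' : Mon} (hmono : Set.MapsTo g (Set.Ici m) (Set.Ici m''))
    (hsurj : Set.SurjOn g (Set.Ici m) (Set.Ici m'')) :
    (cone m).map (Finsupp.mapDomain.addMonoidHom g) = cone m'' := by
  classical
  apply le_antisymm
  · rintro _ ⟨f, hf, rfl⟩ m' hm'
    obtain ⟨y, hy, rfl⟩ := Finset.mem_image.mp (Finsupp.mapDomain_support hm')
    exact hmono (hf y hy)
  · intro f hf
    refine ⟨Finsupp.mapDomain (Function.invFunOn g (Set.Ici m)) f, ?_, ?_⟩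
    · intro m' hm'
      obtain ⟨y, hy, rfl⟩ := Finset.mem_image.mp (Finsupp.mapDomain_support hm')
      exact Function.invFunOn_mem (hsurj (hf y hy))
    · show Finsupp.mapDomain g (Finsupp.mapDomain _ f) = f
      rw [← Finsupp.mapDomain_comp]
      conv_rhs => rw [← Finsupp.mapDomain_id (v := f)]
      refine Finsupp.mapDomain_congr fun y hy => ?_
      exact Function.invFunOn_eq (hsurj (hf y hy))

/-! ## The index maps `g_{d,k} = (· + k·x) ∘ φ^d` -/

/-- Translation by `x^k` on monomials (`k ∈ ℤ`). [claim: Mochizuki2012, status: disputed] (IUTchII §1 Prop 1.5 (i), kurims p.29) -/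
def addX (k : ℤ) (m : Mon) : Mon := (m.1 + k, m.2)

/-- `x`-exponent of a translate. [claim: Mochizuki2012, status: disputed] (IUTchII §1 Prop 1.5 (i), kurims p.29) -/
@[simp] theorem addX_fst (k : ℤ) (m : Mon) : (addX k m).1 = m.1 + k := rfl
/-- `v`-part of a translate. [claim: Mochizuki2012, status: disputed] (IUTchII §1 Prop 1.5 (i), kurims p.29) -/
@[simp] theorem addX_snd (k : ℤ) (m : Mon) : (addX k m).2 = m.2 := rfl

/-- Translation by `x^0` is the identity. [claim: Mochizuki2012, status: disputed] (IUTchII §1 Prop 1.5 (i), kurims p.29) -/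
theorem addX_zero : addX 0 = id := by
  funext m; ext1 <;> simp

/-- Translations compose additively. [claim: Mochizuki2012, status: disputed] (IUTchII §1 Prop 1.5 (i), kurims p.29) -/
theorem addX_addX (k k' : ℤ) (m : Mon) : addX k (addX k' m) = addX (k' + k) m := by
  ext1 <;> simp [add_assoc]

/-- Translation by `x^k` is an order automorphism of the monomials. [claim: Mochizuki2012, status: disputed] (IUTchII §1 Prop 1.5 (i), kurims p.29) -/
theorem addX_le_addX_iff (k : ℤ) {m m' : Mon} : addX k m ≤ addX k m' ↔ m ≤ m' := by
  simp only [Prod.le_def, addX_fst, addX_snd, add_le_add_iff_right]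

/-- `φ(x^k · m) = x^{3k} · φ(m)`: the descent law `φ ∘ U^k = U^{3k} ∘ φ`. [claim: Mochizuki2012, status: disputed] (IUTchII §1 Prop 1.5 (i), kurims p.29) -/
theorem φ_addX (k : ℤ) (m : Mon) : φ (addX k m) = addX (3 * k) (φ m) := by
  ext1
  · rw [φ_fst, addX_fst, addX_fst, addX_snd, φ_fst]; ring
  · rw [φ_snd, addX_snd, addX_snd, φ_snd]

/-- `φ` iterated `d` times, as an additive endomorphism. [claim: Mochizuki2012, status: disputed] (IUTchII §1 Prop 1.5 (i), kurims p.29) -/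
def φpow : ℕ → (Mon →+ Mon)
  | 0 => AddMonoidHom.id Mon
  | d + 1 => φ.comp (φpow d)

/-- `φ^0 = id`. [claim: Mochizuki2012, status: disputed] (IUTchII §1 Prop 1.5 (i), kurims p.29) -/
@[simp] theorem φpow_zero_apply (m : Mon) : φpow 0 m = m := rfl

/-- `φ^{d+1} = φ ∘ φ^d`. [claim: Mochizuki2012, status: disputed] (IUTchII §1 Prop 1.5 (i), kurims p.29) -/
theorem φpow_succ (d : ℕ) (m : Mon) : φpow (d + 1) m = φ (φpow d m) := rfl

/-- `φ^{d+d'} = φ^d ∘ φ^{d'}`. [claim: Mochizuki2012, status: disputed] (IUTchII §1 Prop 1.5 (i), kurims p.29) -/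
theorem φpow_add (d d' : ℕ) (m : Mon) : φpow (d + d') m = φpow d (φpow d' m) := by
  induction d with
  | zero => simp
  | succ d ih => rw [Nat.add_right_comm, φpow_succ, φpow_succ, ih]

/-- `φ^d(x^k · m) = x^{3^d k} · φ^d(m)`. [claim: Mochizuki2012, status: disputed] (IUTchII §1 Prop 1.5 (i), kurims p.29) -/
theorem φpow_addX (d : ℕ) (k : ℤ) (m : Mon) : φpow d (addX k m) = addX (3 ^ d * k) (φpow d m) := by
  induction d with
  | zero => simp
  | succ d ih => rw [φpow_succ, φpow_succ, ih, φ_addX, pow_succ]; ring_nf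

/-- `φ^d` is monotone. [claim: Mochizuki2012, status: disputed] (IUTchII §1 Prop 1.5 (i), kurims p.29) -/
theorem φpow_mono (d : ℕ) {m m' : Mon} (h : m ≤ m') : φpow d m ≤ φpow d m' := by
  induction d with
  | zero => simpa using h
  | succ d ih => rw [φpow_succ, φpow_succ]; exact φ_mono ih

/-- `φ^d` maps the up-set of `m` onto the up-set of `φ^d(m)`. [claim: Mochizuki2012, status: disputed] (IUTchII §1 Prop 1.5 (i), kurims p.29) -/
theorem φpow_surjOn (d : ℕ) (m : Mon) : Set.SurjOn (φpow d) (Set.Ici m) (Set.Ici (φpow d m)) := by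
  induction d with
  | zero =>
    intro y hy
    exact ⟨y, by simpa using hy, by simp⟩
  | succ d ih =>
    have h : Set.SurjOn (φ ∘ φpow d) (Set.Ici m) (Set.Ici (φ (φpow d m))) := (φ_surjOn (φpow d m)).comp ih
    intro y hy
    obtain ⟨z, hz, hzy⟩ := h (by rw [φpow_succ] at hy; exact hy)
    exact ⟨z, hz, by rw [φpow_succ]; exact hzy⟩

/-- The index map `g_{d,k} : m ↦ x^k · φ^d(m)`. [claim: Mochizuki2012, status: disputed] (IUTchII §1 Prop 1.5 (i), kurims p.29) -/
def gmap (d : ℕ) (k : ℤ) (m : Mon) : Mon := addX k (φpow d m)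

/-- `g_{0,0} = id`. [claim: Mochizuki2012, status: disputed] (IUTchII §1 Prop 1.5 (i), kurims p.29) -/
theorem gmap_zero_zero : gmap 0 0 = id := by
  funext m; simp [gmap, addX_zero]

/-- THE COCYCLE LAW of the index maps: `g_{d,k} ∘ g_{d',k'} = g_{d+d', k + 3^d k'}`. [claim: Mochizuki2012, status: disputed] (IUTchII §1 Prop 1.5 (i), kurims p.29) -/
theorem gmap_comp (d d' : ℕ) (k k' : ℤ) :
    gmap d k ∘ gmap d' k' = gmap (d + d') (k + 3 ^ d * k') := by
  funext m
  simp only [Function.comp_apply, gmap]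
  rw [φpow_addX, addX_addX, φpow_add, add_comm k]

/-- `g_{d,k}` maps the up-set of `m` into the up-set of `g_{d,k}(m)`. [claim: Mochizuki2012, status: disputed] (IUTchII §1 Prop 1.5 (i), kurims p.29) -/
theorem gmap_mapsTo (d : ℕ) (k : ℤ) (m : Mon) : Set.MapsTo (gmap d k) (Set.Ici m) (Set.Ici (gmap d k m)) :=
  fun _ hy => Set.mem_Ici.mpr ((addX_le_addX_iff k).mpr (φpow_mono d (Set.mem_Ici.mp hy)))

/-- `g_{d,k}` maps the up-set of `m` onto the up-set of `g_{d,k}(m)`. [claim: Mochizuki2012, status: disputed] (IUTchII §1 Prop 1.5 (i), kurims p.29) -/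
theorem gmap_surjOn (d : ℕ) (k : ℤ) (m : Mon) : Set.SurjOn (gmap d k) (Set.Ici m) (Set.Ici (gmap d k m)) := by
  intro y hy
  have hy' : addX (-k) y ∈ Set.Ici (φpow d m) := by
    rw [Set.mem_Ici] at hy ⊢
    have := (addX_le_addX_iff (-k)).mpr hy
    rwa [gmap, addX_addX, add_neg_cancel, addX_zero] at this
  obtain ⟨z, hz, hzy⟩ := φpow_surjOn d m hy'
  refine ⟨z, hz, ?_⟩
  rw [gmap, hzy, addX_addX, neg_add_cancel, addX_zero, id]

/-- `g_{d,k}` carries the cone of `m` onto the cone of `g_{d,k}(m)`. [claim: Mochizuki2012, status: disputed] (IUTchII §1 Prop 1.5 (i), kurims p.29) -/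
theorem map_cone_gmap (d : ℕ) (k : ℤ) (m : Mon) :
    (cone m).map (Finsupp.mapDomain.addMonoidHom (gmap d k)) = cone (gmap d k m) :=
  map_cone_eq (gmap_mapsTo d k m) (gmap_surjOn d k m)

/-! ## The order-theoretic core: the `x`-chain and its automorphisms -/

/-- The monomials `m` below which (`m' ≤ m`) the order is TOTAL are exactly the pure powers of `x`. [claim: Mochizuki2012, status: disputed] (IUTchII §1 Prop 1.5 (i), kurims p.29) -/
theorem total_below_iff (m : Mon) :
    (∀ m' m'' : Mon, m' ≤ m → m'' ≤ m → (m' ≤ m'' ∨ m'' ≤ m')) ↔ m.2 = 0 := by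
  constructor
  · intro h
    by_contra hne
    obtain ⟨i, hi⟩ := Multiset.exists_mem_of_ne_zero hne
    have h1 : ((m.1 - 1, m.2) : Mon) ≤ m := Prod.le_def.mpr ⟨by simp, le_rfl⟩
    have h2 : ((m.1, m.2.erase i) : Mon) ≤ m := Prod.le_def.mpr ⟨le_rfl, Multiset.erase_le _ _⟩
    rcases h _ _ h1 h2 with h3 | h3
    · have := (Prod.le_def.mp h3).2
      exact absurd (le_antisymm this (Multiset.erase_le _ _)) (Multiset.erase_lt.mpr hi).ne'
    · have := (Prod.le_def.mp h3).1
      simp at this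
  · intro h m' m'' h' h''
    have e' : m'.2 = 0 := Multiset.le_zero.mp (h ▸ (Prod.le_def.mp h').2)
    have e'' : m''.2 = 0 := Multiset.le_zero.mp (h ▸ (Prod.le_def.mp h'').2)
    rcases le_total m'.1 m''.1 with hle | hle
    · exact Or.inl (Prod.le_def.mpr ⟨hle, by rw [e', e'']⟩)
    · exact Or.inr (Prod.le_def.mpr ⟨hle, by rw [e', e'']⟩)

/-- An order automorphism of `ℤ` is a translation. [claim: Mochizuki2012, status: disputed] (IUTchII §1 Prop 1.5 (i), kurims p.29) -/
theorem int_orderAuto_eq_add (g : ℤ → ℤ) (hsurj : Function.Surjective g) (hle : ∀ a b, a ≤ b ↔ g a ≤ g b) :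
    ∃ s : ℤ, ∀ n, g n = n + s := by
  have hlt : ∀ a b, a < b ↔ g a < g b := fun a b => by
    rw [← not_le, ← not_le, hle]
  have hstep : ∀ n, g (n + 1) = g n + 1 := by
    intro n
    obtain ⟨k, hk⟩ := hsurj (g n + 1)
    have h1 : g n < g k := by omega
    have h2 : n < k := (hlt n k).mpr h1
    have h3 : g (n + 1) ≤ g k := (hle _ _).mp (by omega)
    have h4 : g n < g (n + 1) := (hlt _ _).mp (by omega)
    omega
  refine ⟨g 0, fun n => ?_⟩
  induction n using Int.induction_on with
  | zero => simp
  | succ i ih => rw [hstep, ih]; ring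
  | pred i ih =>
    have := hstep (-(i : ℤ) - 1)
    rw [show -(i : ℤ) - 1 + 1 = -(i : ℤ) by ring] at this
    omega

/-- `g_{1,k}(x^n) = x^{3n+k}`. [claim: Mochizuki2012, status: disputed] (IUTchII §1 Prop 1.5 (i), kurims p.29) -/
theorem gmap_one_pure (k n : ℤ) : gmap 1 k (n, 0) = (3 * n + k, 0) := by
  refine Prod.ext ?_ ?_
  · show (φ (φpow 0 (n, 0))).1 + k = 3 * n + k
    rw [φpow_zero_apply, φ_fst]
    simp
  · show (φ (φpow 0 (n, 0))).2 = 0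
    rw [φpow_zero_apply, φ_snd]
    simp

end LimOneToy

end Literature.IUT.HodgeArakelov
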